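import Summits.BirchSwinnertonDyer.BirchSwinnertonDyer.Theorems.PrintCf2RubinValueTwoEllipticUnitsLocalMeasure
import Literature.NumberTheory.EllipticCurves.PAdicOneVariableRelNormCoherentUnitsOfGlobalMonoid
import HarnessLib

/-!
# The elliptic units as a `Γ_K`-monoid of GLOBAL norm-coherent unit sequences, the one-`𝔓` measure family of
# de Shalit II.4.6 as a named function, and the `Gal(K̄/K(𝔪))`-equivariance / additivity of `b ↦ i_𝔓(b_𝔓)`
# (the inputs of the induction `G = Gal(K̄/K(𝔪)) ↝ 𝒢 = Γ_K` of de Shalit's measure, brick B2 — part 1 of 2)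

Cell `bsd-print-cf2`, width seat `bsd-line-cf2-p1-w8` g9 (piece B2 of the measure side of de Shalit II.4 at `p = 2`, cf2c-w4
g10's successor list (2)); `--supports` the banked S3a item stmt-BirchSwinnertonDyer-24721 (helper, Theses-free).  THEOREMS + two
definitions by choice (`ellipticUnitsGlobal`, `localMeasureFamily`); CONDITIONAL on the published named facts
`DeShalit1987.prop24_ii_galoisAction`, `prop24_iii_unit`, `prop25_i_normRelation` (hypotheses, never asserted).

PRINT (de Shalit II.4.1, p. 56: "`𝒢 = Gal(F_∞/K)`, `G = Gal(F_∞/F)` … needless to say, `𝒢` acts"; II.4.9 (23)–(24), p. 62: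
`e(𝔞) = lim e_n(𝔞)` w.r.t. `N_{m,n}`, `β(𝔞)` its projection to `𝒰`; II.4.6 (14), p. 59: "a unique `𝒢`-homomorphism `i : 𝒰 → Λ(𝒢, R̂)`"; II.2.4 (ii): the relation
`e(𝔞𝔠) = σ_𝔠 e(𝔞) · e(𝔠)^{N𝔞}`).  The one-`𝔓` assembly `EllipticUnitsLocal.exists_groupDistribution_twisting_eq_induce_ellipticUnitsLocal`
(p747710) works on `H = Gal(K̄/K(𝔪))` with the `𝔓`-adic units; the induction to `Γ_K` (`GroupDistribution.induceFrom`) needs the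
GLOBAL elliptic units as a `Γ_K`-monoid (`GlobalNormCoherentUnits`, `RayClassTowerGlobalUnits.lean`) and the `H`-equivariance /
additivity of `b ↦ i_𝔓(b_𝔓)`.  THIS file (part 1; part 2 = `…EllipticUnitsGlobalMeasure.lean` assembles II.4.12 on `Γ_K`):

* §1 `ellipticUnitsGlobal` — the elliptic units `e(𝔠) = (Θ(1; 𝔪v^{m+1}, 𝔠))_m` as a norm-coherent sequence of GLOBAL units
  (II.2.4 (iii), II.2.5 (i)), and ★ `hrel_ellipticUnitsGlobal` — II.2.4 (ii) `σ_𝔠 • e(𝔞) · e(𝔠)^{N𝔞} = σ_𝔞 • e(𝔠) · e(𝔞)^{N𝔠}` in the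
  `Γ_K`-monoid for ANY Artin lifts `σ_𝔞, σ_𝔠 ∈ Γ_K` (no "`σ ∈ Gal(K̄/K(𝔪))`");
* §2 `ofGlobalUnits_ellipticUnitsGlobal` (the `𝔓`-component of `e(𝔠)` IS `ellipticUnitsLocal`, `rfl`), `localMeasureFamily` — the
  one-`𝔓` family `β ↦ i_𝔓(β)` of p747710 VERBATIM as a named function — with `localMeasureFamily_μ_smul/_μ_mul` (the package's
  `induce_μ_smul/_mul_seriesFamily`), and ★ `globalMeasureFamily_μ_smul/_μ_mul`: the `hiH_smul`/`hiH_mul` of `induceFrom` for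
  `b ↦ i_𝔓(b_𝔓)` (`rayAction_smul_ofGlobalUnits`: the `κ_v`-action IS the restricted `Γ_K`-action).

HONEST FRAMING: an assembly of accepted kernel theorems over published named facts; nothing here closes a crux; no summit statement is
proved; BSD is not proved by any of this.

## References
* [deShalit1987] E. de Shalit, *Iwasawa theory of elliptic curves with complex multiplication* (1987), II.4.1 (p. 56), II.4.9 (23)–(24)
  (p. 62), II.4.6 (14) (p. 59), II.2.4 (ii)–(iii) (p. 44), II.2.5 (i) (p. 47), I.3.4 (p. 18).
-/


-- the summit namespace `Summit.BirchSwinnertonDyer.BirchSwinnertonDyer` repeats the problem name by design (D-0017)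
set_option linter.dupNamespace false
set_option autoImplicit false

noncomputable section

open scoped Classical nonZeroDivisors
open scoped NumberField
open Field IsDedekindDomain IsDedekindDomain.HeightOneSpectrum ValuativeRel IsLocalRing MvPowerSeries
open Literature.NumberTheory.NumberFields
open Literature.NumberTheory.GaloisRepresentations Literature.NumberTheory.GaloisRepresentations.IsNonarchimedeanLocalField
  Literature.NumberTheory.GaloisRepresentations.LubinTate Literature.NumberTheory.GaloisRepresentations.ArtinLocalGlobal
  Literature.NumberTheory.PAdicHodge
open Literature.NumberTheory.EllipticCurves Literature.NumberTheory.EllipticCurves.GroupDistribution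
open Literature.NumberTheory.ComplexMultiplication.EllipticUnits
open Literature.NumberTheory.LFunctions.AbelianDensity (artinSymbol)
open Summit.BirchSwinnertonDyer.BirchSwinnertonDyer.Theorems.PrintCf2.EllipticUnitsLocal

namespace Summit.BirchSwinnertonDyer.BirchSwinnertonDyer.Theorems.PrintCf2.EllipticUnitsGlobal

variable {K : Type} [Field K] [NumberField K] {𝔪 : Ideal (𝓞 K)} {v : HeightOneSpectrum (𝓞 K)}

attribute [local instance] GlobalNormCoherentUnits.instCommMonoid GlobalNormCoherentUnits.galAction

/-! ## §1. The elliptic units as GLOBAL norm-coherent unit sequences; the relation II.2.4 (ii) in the `Γ_K`-monoid -/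

section Global

variable (h24ii : DeShalit1987.prop24_ii_galoisAction) (h24iii : DeShalit1987.prop24_iii_unit)
  (h25 : DeShalit1987.prop25_i_normRelation) (hK : IsImaginaryQuadratic K) (ι : K →+* ℂ)
  (h𝔪0 : 𝔪 ≠ ⊥) (h𝔪1 : 𝔪 ≠ ⊤) (hv : ¬ 𝔪 ≤ v.asIdeal) (hw : ∀ u : (𝓞 K)ˣ, (u : 𝓞 K) - 1 ∈ 𝔪 → u = 1)

include h24iii h25 hK ι h𝔪1 hv hw in
/-- ★ **THE ELLIPTIC UNITS `e(𝔞) = (Θ(1; 𝔪v^{m+1}, 𝔞))_m` AS A NORM-COHERENT SEQUENCE OF GLOBAL UNITS** (de Shalit II.4.9 (23)–(24)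
`e(𝔞) = lim e_n(𝔞)` w.r.t. `N_{m,n}` — the global datum, whose projection to `𝒰` is `β(𝔞)`): for ANY family `x_m ∈ K(𝔪v^{m+1})` under the theta values —
units by II.2.4 (iii), norm-coherent by II.2.5 (i).  GIVEN the two named facts. [cite: deShalit1987, II.4.9 (23)–(24) (p. 62), II.2.4 (iii), II.2.5 (i)] -/
def ellipticUnitsGlobal {𝔞 : Ideal (𝓞 K)} (h𝔞0 : 𝔞 ≠ ⊥) (h𝔞c : IsCoprime 𝔞 (𝔪 * v.asIdeal))
    (x : ∀ m : ℕ, rayClassField K (𝔪 * v.asIdeal ^ (m + 1)))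
    (hx : ∀ m, IsThetaValueOne ι (𝔪 * v.asIdeal ^ (m + 1)) 𝔞
      (algClosureEmb ι ((x m : rayClassField K (𝔪 * v.asIdeal ^ (m + 1))) : AlgebraicClosure K))) :
    GlobalNormCoherentUnits h𝔪0 v where
  val := x
  ne_zero m := ne_zero_of_isThetaValueOne ι (mul_pow_succ_ne_top 𝔪 v m) (isCoprime_mul_pow_succ h𝔞c m) (hx m)
  isIntegral m := (isIntegral_and_inv_of_isThetaValueOne h24iii hK ι h𝔪0 h𝔪1 hv h𝔞0 h𝔞c m (hx m)).1
  isIntegral_inv m := (isIntegral_and_inv_of_isThetaValueOne h24iii hK ι h𝔪0 h𝔪1 hv h𝔞0 h𝔞c m (hx m)).2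
  coherent _ _ hnm := coe_towerNorm_eq_of_isThetaValueOne h25 hK ι h𝔪0 (unitsInjectiveMod_of_forall hw) v h𝔞0 h𝔞c x hx hnm

/-- Components of the global elliptic units (unfolding): `e(𝔞)_m = x_m`. [cite: deShalit1987, II.4.9 (23)–(24) (p. 62)] -/
theorem val_ellipticUnitsGlobal {𝔞 : Ideal (𝓞 K)} (h𝔞0 : 𝔞 ≠ ⊥) (h𝔞c : IsCoprime 𝔞 (𝔪 * v.asIdeal))
    (x : ∀ m : ℕ, rayClassField K (𝔪 * v.asIdeal ^ (m + 1)))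
    (hx : ∀ m, IsThetaValueOne ι (𝔪 * v.asIdeal ^ (m + 1)) 𝔞
      (algClosureEmb ι ((x m : rayClassField K (𝔪 * v.asIdeal ^ (m + 1))) : AlgebraicClosure K))) (m : ℕ) :
    (ellipticUnitsGlobal h24iii h25 hK ι h𝔪0 h𝔪1 hv hw h𝔞0 h𝔞c x hx).val m = x m := rfl

include h24ii in
/-- ★ **THE `hrel` OF THE GLOBAL ELLIPTIC UNITS in the `Γ_K`-monoid** (de Shalit II.2.4 (ii), symmetric form): for non-zero `𝔞`, `𝔠`
prime to `𝔪v`, families `x^𝔞`, `x^𝔠` under the theta values, and ANY `g_𝔞, g_𝔠 ∈ Γ_K` acting on every `K(𝔪v^{m+1})` as the Artin symbols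
(`exists_forall_absRestrictNormalHom_eq_artinSymbol` — no condition "`g ∈ Gal(K̄/K(𝔪))`"):
`g_𝔠 • e(𝔞) · e(𝔠)^{N𝔞} = g_𝔞 • e(𝔠) · e(𝔞)^{N𝔠}` — the shape `σ c • β a * β c ^ Nm a = σ a • β c * β a ^ Nm c` of the division theorem.
[cite: deShalit1987, II.2.4 Proposition (ii), II.4.12 (p. 66)] -/
theorem hrel_ellipticUnitsGlobal {𝔞 𝔠 : Ideal (𝓞 K)} (h𝔞0 : 𝔞 ≠ ⊥) (h𝔞c : IsCoprime 𝔞 (𝔪 * v.asIdeal))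
    (h𝔠0 : 𝔠 ≠ ⊥) (h𝔠c : IsCoprime 𝔠 (𝔪 * v.asIdeal))
    (xa : ∀ m : ℕ, rayClassField K (𝔪 * v.asIdeal ^ (m + 1)))
    (hxa : ∀ m, IsThetaValueOne ι (𝔪 * v.asIdeal ^ (m + 1)) 𝔞
      (algClosureEmb ι ((xa m : rayClassField K (𝔪 * v.asIdeal ^ (m + 1))) : AlgebraicClosure K)))
    (xc : ∀ m : ℕ, rayClassField K (𝔪 * v.asIdeal ^ (m + 1)))
    (hxc : ∀ m, IsThetaValueOne ι (𝔪 * v.asIdeal ^ (m + 1)) 𝔠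
      (algClosureEmb ι ((xc m : rayClassField K (𝔪 * v.asIdeal ^ (m + 1))) : AlgebraicClosure K)))
    (ga gc : absoluteGaloisGroup K)
    (hga : ∀ m : ℕ, absRestrictNormalHom (rayClassField K (𝔪 * v.asIdeal ^ (m + 1))) ga =
      artinSymbol (galFrob K (rayClassField K (𝔪 * v.asIdeal ^ (m + 1)))) 𝔞)
    (hgc : ∀ m : ℕ, absRestrictNormalHom (rayClassField K (𝔪 * v.asIdeal ^ (m + 1))) gc =
      artinSymbol (galFrob K (rayClassField K (𝔪 * v.asIdeal ^ (m + 1)))) 𝔠) :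
    gc • ellipticUnitsGlobal h24iii h25 hK ι h𝔪0 h𝔪1 hv hw h𝔞0 h𝔞c xa hxa *
        ellipticUnitsGlobal h24iii h25 hK ι h𝔪0 h𝔪1 hv hw h𝔠0 h𝔠c xc hxc ^ Ideal.absNorm 𝔞 =
      ga • ellipticUnitsGlobal h24iii h25 hK ι h𝔪0 h𝔪1 hv hw h𝔠0 h𝔠c xc hxc *
        ellipticUnitsGlobal h24iii h25 hK ι h𝔪0 h𝔪1 hv hw h𝔞0 h𝔞c xa hxa ^ Ideal.absNorm 𝔠 := by
  refine GlobalNormCoherentUnits.ext_coe fun m ↦ ?_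
  rw [GlobalNormCoherentUnits.coe_val_mul, GlobalNormCoherentUnits.coe_val_mul, GlobalNormCoherentUnits.coe_val_pow,
    GlobalNormCoherentUnits.coe_val_pow, GlobalNormCoherentUnits.val_smul, GlobalNormCoherentUnits.val_smul,
    val_ellipticUnitsGlobal, val_ellipticUnitsGlobal, hga m, hgc m]
  exact artin_mul_pow_eq h24ii hK ι (mul_pow_succ_ne_bot h𝔪0 v m) (mul_pow_succ_ne_top 𝔪 v m) h𝔞0 (isCoprime_mul_pow_succ h𝔞c m)
    h𝔠0 (isCoprime_mul_pow_succ h𝔠c m) (hxa m) (hxc m)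

end Global

/-! ## §2. The one-`𝔓` measure family of p747710 as a named function; its `𝔓`-component dictionary -/

section Local

attribute [local instance] ltNormUniformSpace ltNormIsUniformAddGroup rk1 nF nE fintypeResidueField
attribute [local instance] RelNormCoherentUnits.instCommMonoid

variable [NumberField.IsTotallyComplex K]
  (h24iii : DeShalit1987.prop24_iii_unit) (h25 : DeShalit1987.prop25_i_normRelation)
  (hK : IsImaginaryQuadratic K) (ι : K →+* ℂ)
  (h𝔪0 : 𝔪 ≠ ⊥) (h𝔪1 : 𝔪 ≠ ⊤) (hv : ¬ 𝔪 ≤ v.asIdeal) (hw : ∀ u : (𝓞 K)ˣ, (u : 𝓞 K) - 1 ∈ 𝔪 → u = 1)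
  (hq : residueFieldCard (v.adicCompletion K) = 2)
  (h2 : (valuation (v.adicCompletion K)).IsUniformizer ((((2 : ℕ) : 𝒪[v.adicCompletion K]) : v.adicCompletion K)))
  (u : 𝒪[v.adicCompletion K]ˣ)
  {α : 𝓞 K} (hα0 : α ≠ 0) (hα𝔪 : α - 1 ∈ 𝔪) (hαw : ∀ w : HeightOneSpectrum (𝓞 K), w ≠ v → α ∉ w.asIdeal)
  {f : ℕ} (hαπ : ((α : K) : v.adicCompletion K) =
    ((((u : 𝒪[v.adicCompletion K]) * ((2 : ℕ) : 𝒪[v.adicCompletion K]) : 𝒪[v.adicCompletion K]) : v.adicCompletion K)) ^ f)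
  (E : IntermediateField (v.adicCompletion K) (AlgebraicClosure (v.adicCompletion K)))
  [FiniteDimensional (v.adicCompletion K) E] [IsGalois (v.adicCompletion K) E] (hE : E ≤ maxUnramified (v.adicCompletion K))
  (hdegE : ∀ w : WeilGroup (v.adicCompletion K),
    WeilGroup.toAbsGalois (v.adicCompletion K) w ∈ E.fixingSubgroup → (f : ℤ) ∣ WeilGroup.deg w)
  {σ₀ : absoluteGaloisGroup (v.adicCompletion K)} (hσ₀ : IsAbsArithFrob σ₀)
  {ε : (maxUnramifiedCompletion (v.adicCompletion K))ˣ}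
  (hε : maxUnramifiedCompletion.galAut (v.adicCompletion K) σ₀ (ε : maxUnramifiedCompletion (v.adicCompletion K)) =
    algebraMap 𝒪[v.adicCompletion K] (maxUnramifiedCompletion (v.adicCompletion K)) (u : 𝒪[v.adicCompletion K]) *
      (ε : maxUnramifiedCompletion (v.adicCompletion K)))
  (θ : CompletedAlgClosure (v.adicCompletion K) →+* ℂ_[2])
  (hθ1 : ∀ z : CBall (v.adicCompletion K), ‖θ (z : CompletedAlgClosure (v.adicCompletion K))‖ ≤ 1)
  (j : unitBall E →+* UnrCoeff (v.adicCompletion K))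
  (hj : j.comp (algebraMap (LTCoeff (v.adicCompletion K)) (unitBall E)) =
    (intToUnrCoeff (v.adicCompletion K)).comp (LTCoeff.of (v.adicCompletion K)).symm.toRingHom)
  (hjC : (algebraMap (UnrCoeff (v.adicCompletion K)) (CBall (v.adicCompletion K))).comp j = unitBallToCBall E)
  (e₂ : v.adicCompletionIntegers K ≃+* ℤ_[2])
  (hΘe : ∀ a : 𝒪[v.adicCompletion K], (θ.comp ((CBall (v.adicCompletion K)).subtype.comp
      (algebraMap (UnrCoeff (v.adicCompletion K)) (CBall (v.adicCompletion K))))) (intToUnrCoeff (v.adicCompletion K) a) =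
    padicIntCast ℂ_[2] (((e₂ : v.adicCompletionIntegers K →+* ℤ_[2]).comp
      (integerEquivAdicCompletionIntegers v).toRingHom) a))
  (ψ : (n : ℕ) → ↥(absRestrictNormalHom (rayClassField K 𝔪)).ker ⧸ (rayAdicTower (𝔪 := 𝔪) h𝔪0 v).U n → ZMod (2 ^ (n + 1)))
  (hψ : ∀ (n : ℕ) (g : ↥(absRestrictNormalHom (rayClassField K 𝔪)).ker), g ∈ (rayAdicTower (𝔪 := 𝔪) h𝔪0 v).U 0 →
    ψ n ((rayAdicTower (𝔪 := 𝔪) h𝔪0 v).proj n g) =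
      PadicInt.toZModPow (n + 1) ((((Units.map (e₂ : v.adicCompletionIntegers K →+* ℤ_[2]).toMonoidHom).comp
        (rayAdicCharacter h𝔪0 hv hw))⁻¹ g : ℤ_[2]ˣ) : ℤ_[2]))
  [hN : ∀ n, ((rayAdicTower (𝔪 := 𝔪) h𝔪0 v).U n).Normal]

omit hN in
/-- **The `𝔓`-component of the global elliptic units IS `ellipticUnitsLocal`** (definitionally). [cite: deShalit1987, II.4.9 (23)–(24) (p. 62)] -/
theorem ofGlobalUnits_ellipticUnitsGlobal {𝔞 : Ideal (𝓞 K)} (h𝔞0 : 𝔞 ≠ ⊥) (h𝔞c : IsCoprime 𝔞 (𝔪 * v.asIdeal))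
    (x : ∀ m : ℕ, rayClassField K (𝔪 * v.asIdeal ^ (m + 1)))
    (hx : ∀ m, IsThetaValueOne ι (𝔪 * v.asIdeal ^ (m + 1)) 𝔞
      (algClosureEmb ι ((x m : rayClassField K (𝔪 * v.asIdeal ^ (m + 1))) : AlgebraicClosure K))) :
    RelNormCoherentUnits.ofGlobalUnits h𝔪0 hv hw (isUniformizer_unit_mul h2 u) hα0 hα𝔪 hαw hαπ E hE hdegE
        (ellipticUnitsGlobal h24iii h25 hK ι h𝔪0 h𝔪1 hv hw h𝔞0 h𝔞c x hx) =
      ellipticUnitsLocal h24iii h25 hK ι h𝔪0 h𝔪1 hv hw (isUniformizer_unit_mul h2 u) hα0 hα𝔪 hαw hαπ E hE hdegE h𝔞0 h𝔞c x hx :=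
  rfl

set_option maxHeartbeats 800000 in
include hv hw hq hE hσ₀ hε θ hθ1 j hjC e₂ ψ hψ in
/-- **The one-`𝔓` measure family `β ↦ i_𝔓(β)` of `…EllipticUnitsLocal.exists_groupDistribution_twisting_eq_induce_ellipticUnitsLocal`**
(p747710) as a named function: `induce` of the `comap`ped Amice inverse of the `Θ`-read relative Coleman log-free series, along
`rayAdicTower h𝔪 v` with the `κ_v`-action (VERBATIM that expression; `rfl`). [cite: deShalit1987, II.4.6 (14) (p. 59), I.3.4 (p. 18)] -/
def localMeasureFamily (β : RelNormCoherentUnits (isUniformizer_unit_mul h2 u) E) :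
    GroupDistribution (rayAdicTower (𝔪 := 𝔪) h𝔪0 v) ℂ_[2] :=
  letI := rayAction h𝔪0 hv hw (isUniformizer_unit_mul h2 u) E hE
  GroupDistribution.induce
    (fun β : RelNormCoherentUnits (isUniformizer_unit_mul h2 u) E ↦
      (GroupDistribution.comap (restrictUnits ((invAmice₁ 2 ((PowerSeries.subst (compSeriesC h2 hσ₀ u hε)
        ((relTildeSeries (isUniformizer_unit_mul h2 u) E hq hE hσ₀
          (LTCoeff.of (v.adicCompletion K) (u : 𝒪[v.adicCompletion K])) β).map j)).map
        (θ.comp ((CBall (v.adicCompletion K)).subtype.comp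
          (algebraMap (UnrCoeff (v.adicCompletion K)) (CBall (v.adicCompletion K))))))
        (norm_coeff_relSeries_le_one hq h2 u E hE hσ₀ hε θ hθ1 j hjC β)).density
        (ProfiniteTower.padicInt_isUniform 2) (unitInv ℂ_[2]) uniformContinuous_unitInv norm_unitInv_le))
        ψ ((rayAdicTower (𝔪 := 𝔪) h𝔪0 v).cellMap_trans (((Units.map (e₂ : v.adicCompletionIntegers K →+* ℤ_[2]).toMonoidHom).comp (rayAdicCharacter h𝔪0 hv hw))⁻¹) ψ hψ)
        ((rayAdicTower (𝔪 := 𝔪) h𝔪0 v).cellMap_injective (((Units.map (e₂ : v.adicCompletionIntegers K →+* ℤ_[2]).toMonoidHom).comp (rayAdicCharacter h𝔪0 hv hw))⁻¹)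
          (mem_rayAdicTower_iff_inv h𝔪0 h𝔪0 hv hw e₂ le_rfl hv) ψ hψ)
        ((rayAdicTower (𝔪 := 𝔪) h𝔪0 v).cellMap_fiberSurj (((Units.map (e₂ : v.adicCompletionIntegers K →+* ℤ_[2]).toMonoidHom).comp (rayAdicCharacter h𝔪0 hv hw))⁻¹)
          (mem_rayAdicTower_iff_inv h𝔪0 h𝔪0 hv hw e₂ le_rfl hv)
          (exists_toZModPow_padicRayAdicCharacter_inv_eq h𝔪0 h𝔪0 hv hw e₂ le_rfl hv) ψ hψ)))
    zero_le_one (fun _ ↦ le_rfl) β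

set_option maxHeartbeats 800000 in
/-- The bound of the one-`𝔓` family is `1`. [cite: deShalit1987, II.4.6 (p. 59)] -/
theorem localMeasureFamily_bound (β : RelNormCoherentUnits (isUniformizer_unit_mul h2 u) E) :
    (localMeasureFamily h𝔪0 hv hw hq h2 u E hE hσ₀ hε θ hθ1 j hjC e₂ ψ hψ β).bound = 1 := rfl

set_option maxHeartbeats 800000 in
include hj hΘe in
/-- ★ **`Gal(K̄/K(𝔪))`-equivariance of the one-`𝔓` family** (`induce_μ_smul_seriesFamily` with `seriesFamily_hgal_rayAction`):
`i_𝔓(g • β)_n(ḡ a) = i_𝔓(β)_n(a)` for every `g ∈ Gal(K̄/K(𝔪))`. [cite: deShalit1987, II.4.6 (14) (p. 59), I.3.4 Lemma (ii) (p. 18)] -/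
theorem localMeasureFamily_μ_smul
    (g : ↥(absRestrictNormalHom (rayClassField K 𝔪)).ker) (β : RelNormCoherentUnits (isUniformizer_unit_mul h2 u) E) (n : ℕ)
    (a : ↥(absRestrictNormalHom (rayClassField K 𝔪)).ker ⧸ (rayAdicTower (𝔪 := 𝔪) h𝔪0 v).U n) :
    letI := rayAction h𝔪0 hv hw (isUniformizer_unit_mul h2 u) E hE
    (localMeasureFamily h𝔪0 hv hw hq h2 u E hE hσ₀ hε θ hθ1 j hjC e₂ ψ hψ (g • β)).μ n
        ((rayAdicTower (𝔪 := 𝔪) h𝔪0 v).proj n g * a) =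
      (localMeasureFamily h𝔪0 hv hw hq h2 u E hE hσ₀ hε θ hθ1 j hjC e₂ ψ hψ β).μ n a := by
  letI := rayAction h𝔪0 hv hw (isUniformizer_unit_mul h2 u) E hE
  exact induce_μ_smul_seriesFamily (hq := hq) (h2 := h2) (hσ₀ := hσ₀) (u := u) (hε := hε)
    (Θ := θ.comp ((CBall (v.adicCompletion K)).subtype.comp
      (algebraMap (UnrCoeff (v.adicCompletion K)) (CBall (v.adicCompletion K)))))
    (e := (e₂ : v.adicCompletionIntegers K →+* ℤ_[2]).comp (integerEquivAdicCompletionIntegers v).toRingHom) (hΘe := hΘe)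
    (κ := ((Units.map (e₂ : v.adicCompletionIntegers K →+* ℤ_[2]).toMonoidHom).comp (rayAdicCharacter h𝔪0 hv hw))⁻¹)
    (hU := mem_rayAdicTower_iff_inv h𝔪0 h𝔪0 hv hw e₂ le_rfl hv)
    (hκ := exists_toZModPow_padicRayAdicCharacter_inv_eq h𝔪0 h𝔪0 hv hw e₂ le_rfl hv) (ψ := ψ) (hψ := hψ)
    (φ := fun β : RelNormCoherentUnits (isUniformizer_unit_mul h2 u) E ↦
      (relTildeSeries (isUniformizer_unit_mul h2 u) E hq hE hσ₀ (LTCoeff.of (v.adicCompletion K) (u : 𝒪[v.adicCompletion K])) β).map j)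
    (hgal := seriesFamily_hgal_rayAction (h𝔪 := h𝔪0) (hv := hv) (hw := hw) (h2 := h2) (u := u) (E := E) (hE := hE) (hq := hq)
      (hσ₀ := hσ₀) (uL := LTCoeff.of (v.adicCompletion K) (u : 𝒪[v.adicCompletion K])) (j := j) (hj := hj)
      (e := (e₂ : v.adicCompletionIntegers K →+* ℤ_[2]).comp (integerEquivAdicCompletionIntegers v).toRingHom)
      (𝒰 := rayAdicTower (𝔪 := 𝔪) h𝔪0 v)
      (κ := (((Units.map (e₂ : v.adicCompletionIntegers K →+* ℤ_[2]).toMonoidHom).comp (rayAdicCharacter h𝔪0 hv hw))⁻¹))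
      (hκ := padicRayAdicCharacter_inv_apply h𝔪0 hv hw e₂))
    (hC := norm_coeff_relSeries_le_one hq h2 u E hE hσ₀ hε θ hθ1 j hjC) (hC0 := zero_le_one) (hCb := fun _ ↦ le_rfl) g β n a

set_option maxHeartbeats 800000 in
/-- ★ **Additivity of the one-`𝔓` family** (`induce_μ_mul_seriesFamily` with `seriesFamily_hadd_rayUnits`):
`i_𝔓(ββ')_n(a) = i_𝔓(β)_n(a) + i_𝔓(β')_n(a)`. [cite: deShalit1987, I.3.4 Lemma (i) (p. 18), II.4.6 (p. 59)] -/
theorem localMeasureFamily_μ_mul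
    (β β' : RelNormCoherentUnits (isUniformizer_unit_mul h2 u) E) (n : ℕ)
    (a : ↥(absRestrictNormalHom (rayClassField K 𝔪)).ker ⧸ (rayAdicTower (𝔪 := 𝔪) h𝔪0 v).U n) :
    (localMeasureFamily h𝔪0 hv hw hq h2 u E hE hσ₀ hε θ hθ1 j hjC e₂ ψ hψ (β * β')).μ n a =
      (localMeasureFamily h𝔪0 hv hw hq h2 u E hE hσ₀ hε θ hθ1 j hjC e₂ ψ hψ β).μ n a +
        (localMeasureFamily h𝔪0 hv hw hq h2 u E hE hσ₀ hε θ hθ1 j hjC e₂ ψ hψ β').μ n a := by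
  letI := rayAction h𝔪0 hv hw (isUniformizer_unit_mul h2 u) E hE
  exact induce_μ_mul_seriesFamily (h2 := h2) (hσ₀ := hσ₀) (u := u) (hε := hε)
    (Θ := θ.comp ((CBall (v.adicCompletion K)).subtype.comp
      (algebraMap (UnrCoeff (v.adicCompletion K)) (CBall (v.adicCompletion K)))))
    (κ := ((Units.map (e₂ : v.adicCompletionIntegers K →+* ℤ_[2]).toMonoidHom).comp (rayAdicCharacter h𝔪0 hv hw))⁻¹)
    (hU := mem_rayAdicTower_iff_inv h𝔪0 h𝔪0 hv hw e₂ le_rfl hv)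
    (hκ := exists_toZModPow_padicRayAdicCharacter_inv_eq h𝔪0 h𝔪0 hv hw e₂ le_rfl hv) (ψ := ψ) (hψ := hψ)
    (φ := fun β : RelNormCoherentUnits (isUniformizer_unit_mul h2 u) E ↦
      (relTildeSeries (isUniformizer_unit_mul h2 u) E hq hE hσ₀ (LTCoeff.of (v.adicCompletion K) (u : 𝒪[v.adicCompletion K])) β).map j)
    (hadd := seriesFamily_hadd_rayUnits (h2 := h2) (u := u) (E := E) (hq := hq) (hE := hE) (hσ₀ := hσ₀)
      (uL := LTCoeff.of (v.adicCompletion K) (u : 𝒪[v.adicCompletion K])) (j := j))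
    (hC := norm_coeff_relSeries_le_one hq h2 u E hE hσ₀ hε θ hθ1 j hjC) (hC0 := zero_le_one) (hCb := fun _ ↦ le_rfl) β β' n a

set_option maxHeartbeats 800000 in
include hj hΘe in
/-- ★ **`H`-equivariance of the GLOBAL family `b ↦ i_𝔓((b)_𝔓)`**: for `h ∈ Gal(K̄/K(𝔪))`,
`i_𝔓(((h : Γ_K) • b)_𝔓)_n(h̄ a) = i_𝔓(b_𝔓)_n(a)` — the `κ_v`-action on `𝒰_𝔓` is the restriction of the `Γ_K`-action
(`rayAction_smul_ofGlobalUnits`) and `localMeasureFamily_μ_smul`.  The `hiH_smul` of `GroupDistribution.induceFrom`.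
[cite: deShalit1987, II.4.6 (14) (p. 59), I.3.4 Lemma (ii) (p. 18), II.4.9 (24) (p. 62)] -/
theorem globalMeasureFamily_μ_smul (h : ↥(absRestrictNormalHom (rayClassField K 𝔪)).ker) (b : GlobalNormCoherentUnits h𝔪0 v)
    (n : ℕ) (a : ↥(absRestrictNormalHom (rayClassField K 𝔪)).ker ⧸ (rayAdicTower (𝔪 := 𝔪) h𝔪0 v).U n) :
    (localMeasureFamily h𝔪0 hv hw hq h2 u E hE hσ₀ hε θ hθ1 j hjC e₂ ψ hψ
        (RelNormCoherentUnits.ofGlobalUnits h𝔪0 hv hw (isUniformizer_unit_mul h2 u) hα0 hα𝔪 hαw hαπ E hE hdegE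
          ((h : absoluteGaloisGroup K) • b))).μ n ((rayAdicTower (𝔪 := 𝔪) h𝔪0 v).proj n h * a) =
      (localMeasureFamily h𝔪0 hv hw hq h2 u E hE hσ₀ hε θ hθ1 j hjC e₂ ψ hψ
        (RelNormCoherentUnits.ofGlobalUnits h𝔪0 hv hw (isUniformizer_unit_mul h2 u) hα0 hα𝔪 hαw hαπ E hE hdegE b)).μ n a := by
  letI := rayAction h𝔪0 hv hw (isUniformizer_unit_mul h2 u) E hE
  rw [← rayAction_smul_ofGlobalUnits h𝔪0 hv hw (isUniformizer_unit_mul h2 u) hα0 hα𝔪 hαw hαπ E hE hdegE h b]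
  exact localMeasureFamily_μ_smul h𝔪0 hv hw hq h2 u E hE hσ₀ hε θ hθ1 j hj hjC e₂ hΘe ψ hψ h _ n a

set_option maxHeartbeats 800000 in
/-- ★ **Additivity of the GLOBAL family** (`ofGlobalUnits_mul` and `localMeasureFamily_μ_mul`) — the `hiH_mul` of
`GroupDistribution.induceFrom`. [cite: deShalit1987, I.3.4 Lemma (i) (p. 18), II.4.9 (24) (p. 62)] -/
theorem globalMeasureFamily_μ_mul (b b' : GlobalNormCoherentUnits h𝔪0 v)
    (n : ℕ) (a : ↥(absRestrictNormalHom (rayClassField K 𝔪)).ker ⧸ (rayAdicTower (𝔪 := 𝔪) h𝔪0 v).U n) :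
    (localMeasureFamily h𝔪0 hv hw hq h2 u E hE hσ₀ hε θ hθ1 j hjC e₂ ψ hψ
        (RelNormCoherentUnits.ofGlobalUnits h𝔪0 hv hw (isUniformizer_unit_mul h2 u) hα0 hα𝔪 hαw hαπ E hE hdegE (b * b'))).μ n a =
      (localMeasureFamily h𝔪0 hv hw hq h2 u E hE hσ₀ hε θ hθ1 j hjC e₂ ψ hψ
          (RelNormCoherentUnits.ofGlobalUnits h𝔪0 hv hw (isUniformizer_unit_mul h2 u) hα0 hα𝔪 hαw hαπ E hE hdegE b)).μ n a +
        (localMeasureFamily h𝔪0 hv hw hq h2 u E hE hσ₀ hε θ hθ1 j hjC e₂ ψ hψ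
          (RelNormCoherentUnits.ofGlobalUnits h𝔪0 hv hw (isUniformizer_unit_mul h2 u) hα0 hα𝔪 hαw hαπ E hE hdegE b')).μ n a := by
  rw [ofGlobalUnits_mul]
  exact localMeasureFamily_μ_mul h𝔪0 hv hw hq h2 u E hE hσ₀ hε θ hθ1 j hjC e₂ ψ hψ _ _ n a

end Local

end Summit.BirchSwinnertonDyer.BirchSwinnertonDyer.Theorems.PrintCf2.EllipticUnitsGlobal

end
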